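/-
Copyright (c) 2026 the pub-hodgecm-mathlib formalisation cell (harness21).  Prover seat hodgecm-mathlib-K2Liu-p11 (g0): Track B «K2-LIT»,
#184♮ = hLiu418 = stmt-HodgeConjecture-24832; socket #33b `sig_K2LiuSiegelBigCellSection` of `Cruxes/HLiu418/Lines/K2_Liu_CurveThetaSigs_U5d_ZetaS.lean`
(U5d ED. 8 :711) — the CLOSER modulo the one-place section packages (LEAD F0P6-plan (g11) RE-DEAL #33b (D) 2026-09-04T05:43:59Z, standing override
05:45:00Z (3); REPORT-FIRST K2/STATUS 06:07Z).
-/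
import Summits.HodgeConjecture.HodgeConjecture.Theorems.K2LiuSiegelBigCellSectionOfLocalPrelims   -- §1–§4: splitting of `δ` over `S`, invariance ∕ read-back of the restricted product, positivity
import HarnessLib

/-!
# Crux `HLiu418`, road `K2_Liu`, unit U5d «`Z_S`», socket #33b: GOOD SECTIONS SUPPORTED IN THE MAIN ORBIT EXIST —
# THE CLOSER MODULO THE ONE-PLACE SECTION PACKAGES

Cell `hodgecm-mathlib`, crux item hLiu418 = `stmt-HodgeConjecture-24832`, route of record `HCCMUnconditional`; squad K2 ∕ K2Liu, LEAD F0P6-plan,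
prover K2Liu-p11 (g0).  THEOREMS ONLY (no `def`, no instance, no notation, no named-fact hypothesis, no `sorry`); lane
`--supports stmt-HodgeConjecture-24832 --as helper` (count-neutral: closes no socket until the one-line tie over the ★ (D-arch) ∕ (D-fin) heads).

THE SHAPE (the ★ #32d precedent `K2LiuDoublingHeightDecayLocalOfSlices.doublingHeightDecayLocal_of_slices`): **#33b FOLLOWS FROM ITS ONE-PLACE SECTION
PACKAGES.**  `siegelBigCellSection_of_localPackages` has the binders of socket #33b (U5d ED. 8 :711) VERBATIM, then TWO BY-VALUE HYPOTHESES — the deliverables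
of the organ files (D-arch) (K2Liu-p10) and (D-fin)+(D2) (K2Liu-p08), each in ITS ORGAN'S NATIVE CHART:
* `hArch` — at `∞`, in the frame `G′_∞ = U(diag dV)(L⁺ ⊗ ℝ)` with the doubling embedding SPELLED `a ↦ (ι(a, 1))_∞ = archPart (iotaLeft (archToAdelic a))`
  (no archimedean `ι` is defined in the tree, ★ `K2LiuDoublingZetaGL1Factor` §1): for every open `U′_∞ ∋ 1` a CONTINUOUS Siegel section `φ_∞` on `H_∞`
  (law through ★ `IsSiegelDelta ∕ siegelDeltaCharacter ∘ archToAdelic`) whose pull-back along the embedding is a bump `g_∞ ∈ C_c(G′_∞)`, `0 ≤ g_∞`,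
  `supp g_∞ ⊆ U′_∞`, `g_∞(1) > 0`;
* `hFin` — at `v ∈ S`, in the frame `G′_v = U(diag dV)(L⁺_v)` of ★ `iotaLeftLocPi v` (the (B3) chart of ★ `K2LiuSiegelBigCellOpenEmbeddingPi`): for every open
  `U′_v ∋ 1` an OPEN `K′_v ≤ H_v`, a LOCALLY CONSTANT right-`K′_v`-invariant local Siegel section `φ_v` (law through ★ `siegelDeltaLoc ∕ siegelCharLoc`) and a
  bump `g_v` as above with `φ_v(ι_v(x,1)) = g_v(x)`;
and concludes the `∃ (K′) (φ♭) (g), …` of #33b VERBATIM.  The closer carries: the frame transport `U(H) ↝ U(diag dV)` (the local congruences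
`κ_v = localCongr g⁻¹ … v`, ★ `K2LiuDoublingZetaGL1Docking.evalPlace_finPart_iotaA`; `Φ_∞`, ★ `exists_archCongr_archPart_iotaA`); the box `U_∞ × ∏_{v∈S} U_v ⊆ U`;
`fS := φ_∞ ⊗ ⊗_{v∈S} φ_v` and the SPLITTING `δ_{χ,s₀}(placesEmbed(a, z)) = δ_{χ,s₀}(a, 1) · ∏_{v∈S} δ_v(z_v)` (§2), whence ★ (c1)
`isSiegelDeltaSection_restrictedProduct` with ★ (c0)'s `hδK`; continuity by ★ (c2); the right invariance under `K^S_H · ∏_{v∈S} K′_v` (peel `k = placesEmbed(1, k_S) · k′`,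
★ `restrictedProduct_mul_of_mem_KS`); the read-back along `ι ∘ ιA ∘ placesEmbed` (★ `evalPlace_finPart_iotaLeft(_eq_one)`, ★ `archPart_iotaLeft_congr`, ★ (A1)(A2));
positivity of `∫ g` on `νinf.prod (Measure.pi νS)` by `Continuous.integral_pos_of_hasCompactSupport_nonneg_nonzero` (Haar ⇒ open-positive and finite on compacts;
no Fubini).

References: [GelbartPiatetskishapiroRallis1987, Part A §1, §6]; [KudlaRallis1994, §1]; [HarrisKudlaSweet1996, §6 (6.27)–(6.28) p. 973]; [Liu2011, §2B–2C pp. 862–864];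
[Tan1999, §1]; [BorelJacquet1979, §4.1]; [PlatonovRapinchuk1994, §2.3, §5.1].
HONEST LABEL: HC_CM is proved only modulo the 7 printed citations (2 remaining named inputs: hLiu418 = stmt-HodgeConjecture-24832,
h413 = stmt-HodgeConjecture-24833) until rung 0 closes; this file is a helper and closes no socket by itself (#33b needs the (D-arch)∕(D-fin) heads).
-/

set_option autoImplicit false
set_option linter.dupNamespace false

noncomputable section

open scoped Matrix RestrictedProduct
open Filter Topology Set MeasureTheory NumberField IsDedekindDomain NumberField.mixedEmbedding
open Literature.NumberTheory.Automorphic Literature.NumberTheory.Automorphic.UnitaryGroup Literature.NumberTheory.GaloisRepresentations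
open Literature.NumberTheory.GelbartRogawski1991 Literature.NumberTheory.GelbartRogawski1991.GRConstruction
open Literature.NumberTheory.K2Lit.SiegelDoubled Literature.NumberTheory.K2Lit.PlaceSplitting
open Summit.HodgeConjecture.HodgeConjecture.Cruxes.HLiu418.K2LiuStdFamilyFactorisable
open Summit.HodgeConjecture.HodgeConjecture.Cruxes.HLiu418.K2LiuSiegelSectionRestrictedProduct
open Summit.HodgeConjecture.HodgeConjecture.Cruxes.HLiu418.K2LiuSiegelSectionRestrictedProductContinuous
open Summit.HodgeConjecture.HodgeConjecture.Cruxes.HLiu418.K2LiuSiegelCharacterTrivialOnKS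
open Summit.HodgeConjecture.HodgeConjecture.Cruxes.HLiu418.K2LiuSiegelBigCellSectionOfLocalPrelims

namespace Summit.HodgeConjecture.HodgeConjecture.Cruxes.HLiu418.K2LiuSiegelBigCellSectionOfLocal

/-! ## The closer modulo the one-place packages -/



set_option maxHeartbeats 800000 in -- the doubled unitary datum's binder telescope (as ★ (c1) §3 ∕ ★ #31s)
/-- **#33b FROM ITS ONE-PLACE SECTION PACKAGES.**  Binders = socket #33b `sig_K2LiuSiegelBigCellSection` (U5d ED. 8 :711) VERBATIM, then the archimedean
package `hArch` ((D-arch), frame `U(diag dV)_∞`, embedding `a ↦ archPart (iotaLeft (archToAdelic a))`) and the finite packages `hFin` ((D-fin)+(D2), frame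
`U(diag dV)_v`, embedding ★ `iotaLeftLocPi v`) BY VALUE; conclusion = the socket's `∃ (K') (φb) (g), …` VERBATIM.  See the module docstring for the proof.
[cite: GelbartPiatetskishapiroRallis1987, Part A §6] [cite: KudlaRallis1994, §1] [cite: HarrisKudlaSweet1996, §6 (6.27)–(6.28) p. 973] [cite: Liu2011, §2C (2-5) pp. 863–864]
[cite: Tan1999, §1] [cite: BorelJacquet1979, §4.1] [cite: PlatonovRapinchuk1994, §2.3, §5.1] -/
theorem siegelBigCellSection_of_localPackages
    (L : Type) [Field L] [NumberField L] [IsCMField L] {N n : ℕ} (e : Fin N × Fin 1 ≃ Fin n)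
      (dV : Fin N → L) (hdV : ∀ i, IsCMField.complexConj L (dV i) = dV i) (_hdV0 : ∀ i, dV i ≠ 0)
      (dW : Fin 1 → L) (hdW : ∀ i, IsCMField.complexConj L (dW i) = dW i) (_hdW0 : ∀ i, dW i ≠ 0)
      (H : Matrix (Fin N) (Fin N) L)
      (t : L) (_ht : t ≠ 0) (g : GL (Fin N) L)
      (_hg : formCongr ((IsCMField.complexConj L : L ≃ₐ[↥(maximalRealSubfield L)] L) : L →+* L) g (t • H) = Matrix.diagonal dV)
      (ιA : (UnitaryGroup.adelicGroupData (Fp L) L (IsCMField.complexConj L) N H).Adelic →*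
        UnitaryGroup.adelic (Fp L) L (IsCMField.complexConj L) N (Matrix.diagonal dV))
      (_hιA : ∀ k, ((ιA k : ↥(UnitaryGroup.adelic (Fp L) L (IsCMField.complexConj L) N (Matrix.diagonal dV))) :
            GL (Fin N) (AdeleRing (𝓞 L) L)) =
          (toAdeleGL L g)⁻¹ * UnitaryGroup.adelicVal (Fp L) L (IsCMField.complexConj L) N H k * toAdeleGL L g)
      (S : Finset (HeightOneSpectrum (𝓞 (Fp L)))) [DecidableEq (HeightOneSpectrum (𝓞 (Fp L)))]
      [MeasurableSpace (UnitaryGroup.arch (Fp L) L (IsCMField.complexConj L) N H)]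
      [BorelSpace (UnitaryGroup.arch (Fp L) L (IsCMField.complexConj L) N H)]
      [∀ v : HeightOneSpectrum (𝓞 (Fp L)), MeasurableSpace (UnitaryGroup.localPi L (IsCMField.complexConj L) N H v)]
      [∀ v : HeightOneSpectrum (𝓞 (Fp L)), BorelSpace (UnitaryGroup.localPi L (IsCMField.complexConj L) N H v)]
      (νinf : Measure (UnitaryGroup.arch (Fp L) L (IsCMField.complexConj L) N H)) [νinf.IsHaarMeasure]
      (νS : ∀ v : S, Measure (UnitaryGroup.localPi L (IsCMField.complexConj L) N H v.1)) [∀ v, (νS v).IsHaarMeasure]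
      (χ : HeckeCharacter L) (_hχ : ∀ v, v ∉ S → ∀ w' : UnitaryGroup.PlacesOver L v, χ.IsUnramifiedAt w'.1)
      (s₀ : ℂ)
      (U : Set (UnitaryGroup.arch (Fp L) L (IsCMField.complexConj L) N H ×
        (Π v : S, UnitaryGroup.localPi L (IsCMField.complexConj L) N H v.1)))
      (_hU : IsOpen U) (_h1 : (1 : UnitaryGroup.arch (Fp L) L (IsCMField.complexConj L) N H ×
        (Π v : S, UnitaryGroup.localPi L (IsCMField.complexConj L) N H v.1)) ∈ U)
    -- (D-arch) BY VALUE: the archimedean section package in the frame `U(diag dV)_∞`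
    (hArch : ∀ (Ui : Set (UnitaryGroup.arch (Fp L) L (IsCMField.complexConj L) N (Matrix.diagonal dV))), IsOpen Ui → (1 : _) ∈ Ui →
      ∃ (φi : UnitaryGroup.arch (Fp L) L (IsCMField.complexConj L) (n + n) (hermD L e dV hdV dW hdW) → ℂ)
        (gi : UnitaryGroup.arch (Fp L) L (IsCMField.complexConj L) N (Matrix.diagonal dV) → ℝ),
        (∀ p u : UnitaryGroup.arch (Fp L) L (IsCMField.complexConj L) (n + n) (hermD L e dV hdV dW hdW),
          IsSiegelDelta L e dV hdV dW hdW (UnitaryGroup.archToAdelic (Fp L) L (IsCMField.complexConj L) (n + n) (hermD L e dV hdV dW hdW) p) →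
          φi (p * u) = siegelDeltaCharacter L e dV hdV dW hdW χ s₀
            (UnitaryGroup.archToAdelic (Fp L) L (IsCMField.complexConj L) (n + n) (hermD L e dV hdV dW hdW) p) * φi u) ∧
        Continuous φi ∧
        (∀ a : UnitaryGroup.arch (Fp L) L (IsCMField.complexConj L) N (Matrix.diagonal dV),
          φi (UnitaryGroup.archPart (Fp L) L (IsCMField.complexConj L) (n + n) (hermD L e dV hdV dW hdW)
            (iotaLeft L e dV hdV dW hdW (UnitaryGroup.archToAdelic (Fp L) L (IsCMField.complexConj L) N (Matrix.diagonal dV) a))) = ((gi a : ℝ) : ℂ)) ∧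
        Continuous gi ∧ HasCompactSupport gi ∧ 0 ≤ gi ∧ Function.support gi ⊆ Ui ∧ 0 < gi 1)
    -- (D-fin)+(D2) BY VALUE: the finite section packages in the frame `U(diag dV)_v`, `v ∈ S`
    (hFin : ∀ (v : S) (Uv : Set (UnitaryGroup.localPi L (IsCMField.complexConj L) N (Matrix.diagonal dV) v.1)), IsOpen Uv → (1 : _) ∈ Uv →
      ∃ (K'v : Subgroup (UnitaryGroup.localPi L (IsCMField.complexConj L) (n + n) (hermD L e dV hdV dW hdW) v.1))
        (φv : UnitaryGroup.localPi L (IsCMField.complexConj L) (n + n) (hermD L e dV hdV dW hdW) v.1 → ℂ)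
        (gv : UnitaryGroup.localPi L (IsCMField.complexConj L) N (Matrix.diagonal dV) v.1 → ℝ),
        IsOpen (K'v : Set (UnitaryGroup.localPi L (IsCMField.complexConj L) (n + n) (hermD L e dV hdV dW hdW) v.1)) ∧
        (∀ p ∈ siegelDeltaLoc L e dV hdV dW hdW v.1, ∀ u, φv (p * u) = siegelCharLoc L e dV hdV dW hdW v.1 χ s₀ p * φv u) ∧
        IsLocallyConstant φv ∧
        (∀ u, ∀ k ∈ K'v, φv (u * k) = φv u) ∧
        (∀ x, φv (iotaLeftLocPi L e dV hdV dW hdW v.1 x) = ((gv x : ℝ) : ℂ)) ∧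
        Continuous gv ∧ HasCompactSupport gv ∧ 0 ≤ gv ∧ Function.support gv ⊆ Uv ∧ 0 < gv 1) :
    ∃ (K' : ∀ v : S, Subgroup (UnitaryGroup.localPi L (IsCMField.complexConj L) (n + n) (hermD L e dV hdV dW hdW) v.1))
      (φb : HA L e dV hdV dW hdW → ℂ)
      (g : UnitaryGroup.arch (Fp L) L (IsCMField.complexConj L) N H ×
        (Π v : S, UnitaryGroup.localPi L (IsCMField.complexConj L) N H v.1) → ℝ),
      (∀ v : S, IsOpen (K' v : Set (UnitaryGroup.localPi L (IsCMField.complexConj L) (n + n) (hermD L e dV hdV dW hdW) v.1))) ∧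
      IsSiegelDeltaSection L e dV hdV dW hdW χ s₀ φb ∧ Continuous φb ∧
      (∀ h k : HA L e dV hdV dW hdW,
        UnitaryGroup.archPart (Fp L) L (IsCMField.complexConj L) (n + n) (hermD L e dV hdV dW hdW) k = 1 →
        (∀ v, v ∉ S → UnitaryGroup.evalPlace (Fp L) L (IsCMField.complexConj L) (n + n) (hermD L e dV hdV dW hdW) v
            (UnitaryGroup.finPart (Fp L) L (IsCMField.complexConj L) (n + n) (hermD L e dV hdV dW hdW) k) ∈
          UnitaryGroup.localInt L (IsCMField.complexConj L) (n + n) (hermD L e dV hdV dW hdW) v) →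
        (∀ v : S, UnitaryGroup.evalPlace (Fp L) L (IsCMField.complexConj L) (n + n) (hermD L e dV hdV dW hdW) v.1
            (UnitaryGroup.finPart (Fp L) L (IsCMField.complexConj L) (n + n) (hermD L e dV hdV dW hdW) k) ∈ K' v) →
        φb (h * k) = φb h) ∧
      (∀ x, φb (iotaLeft L e dV hdV dW hdW (ιA (placesEmbed L H S x))) = ((g x : ℝ) : ℂ)) ∧
      0 ≤ g ∧ Function.support g ⊆ U ∧
      0 < ∫ x, g x ∂(νinf.prod (Measure.pi νS)) := by
  classical
  /- §A. FRAME TRANSPORT `U(H) ↝ U(diag dV)`: the archimedean congruence `Φ_∞` and the local congruences `κ_v` with the component identities of `ιA` (★ Docking). -/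
  obtain ⟨Φi, -, hΦi⟩ := K2LiuDoublingZetaGL1Docking.exists_archCongr_archPart_iotaA L H dV t _ht g _hg ιA _hιA
  obtain ⟨κ, hκ⟩ : ∃ κ : ∀ v : S, (UnitaryGroup.localPi L (IsCMField.complexConj L) N H v.1 ≃ₜ* UnitaryGroup.localPi L (IsCMField.complexConj L) N (Matrix.diagonal dV) v.1),
      ∀ (v : S) (x : (UnitaryGroup.adelicGroupData (Fp L) L (IsCMField.complexConj L) N H).Adelic),
        UnitaryGroup.evalPlace (Fp L) L (IsCMField.complexConj L) N (Matrix.diagonal dV) v.1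
            (UnitaryGroup.finPart (Fp L) L (IsCMField.complexConj L) N (Matrix.diagonal dV) (ιA x)) =
          κ v (UnitaryGroup.evalPlace (Fp L) L (IsCMField.complexConj L) N H v.1 (UnitaryGroup.finPart (Fp L) L (IsCMField.complexConj L) N H x)) :=
    ⟨fun v => localCongr L (IsCMField.complexConj L) g⁻¹ (inv_ne_zero _ht) (K2LiuDoublingZetaGL1Docking.formCongr_inv_diagonal L H dV t _ht g _hg) v.1,
      fun v x => K2LiuDoublingZetaGL1Docking.evalPlace_finPart_iotaA L H dV t _ht g _hg ιA _hιA x v.1⟩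
  /- §B. THE BOX `U_∞ × ∏_{v∈S} U_v ⊆ U`. -/
  obtain ⟨Ui, W, hUio, hWo, h1Ui, h1W, hUW⟩ := isOpen_prod_iff.1 _hU 1 1 _h1
  obtain ⟨Uv, hUv, hUvW⟩ := isOpen_pi_iff'.1 hWo 1 h1W
  /- §C. THE PACKAGES, on the transported boxes. -/
  obtain ⟨φi, gi, hφi_law, hφi_cont, hφi_read, hgi_cont, hgi_cs, hgi_nn, hgi_supp, hgi_one⟩ :=
    hArch (Φi.symm ⁻¹' Ui) (hUio.preimage Φi.symm.continuous) (by rw [Set.mem_preimage, map_one]; exact h1Ui)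
  choose K' φv gv hK'o hφv_law hφv_lc hφv_inv hφv_read hgv_cont hgv_cs hgv_nn hgv_supp hgv_one using
    fun v : S => hFin v ((κ v).symm ⁻¹' Uv v) ((hUv v).1.preimage (κ v).symm.continuous) (by rw [Set.mem_preimage, map_one]; exact (hUv v).2)
  /- §D. `fS := φ_∞ ⊗ ⊗_{v∈S} φ_v` is a continuous `δ ∘ placesEmbed`-section on `H_∞ × ∏_{v∈S} H_v`, by the §2 splitting. -/
  obtain ⟨fS, hfS_def⟩ : ∃ fS : UnitaryGroup.arch (Fp L) L (IsCMField.complexConj L) (n + n) (hermD L e dV hdV dW hdW) ×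
      (Π v : S, UnitaryGroup.localPi L (IsCMField.complexConj L) (n + n) (hermD L e dV hdV dW hdW) v.1) → ℂ, fS = fun p => φi p.1 * ∏ v : S, φv v (p.2 v) := ⟨_, rfl⟩
  have hfS : ∀ x, IsSiegelDelta L e dV hdV dW hdW (placesEmbed L (hermD L e dV hdV dW hdW) S x) →
      ∀ y, fS (x * y) = siegelDeltaCharacter L e dV hdV dW hdW χ s₀ (placesEmbed L (hermD L e dV hdV dW hdW) S x) * fS y := by
    rintro ⟨a, z⟩ hp ⟨b, w⟩
    obtain ⟨ha, hz, hδ⟩ := split_of_isSiegelDelta_placesEmbed L e dV hdV dW hdW S χ s₀ a z hp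
    rw [hδ, hfS_def]
    simp only [Prod.fst_mul, Prod.snd_mul, Pi.mul_apply]
    rw [hφi_law a b ha, Finset.prod_congr rfl fun v _ => hφv_law v (z v) (hz v) (w v), Finset.prod_mul_distrib]
    ring
  have hfSc : Continuous fS := by
    rw [hfS_def]
    exact (hφi_cont.comp continuous_fst).mul (continuous_finsetProd _ fun v _ => (hφv_lc v).continuous.comp ((continuous_apply v).comp continuous_snd))
  have hfSK : ∀ (a : UnitaryGroup.arch (Fp L) L (IsCMField.complexConj L) (n + n) (hermD L e dV hdV dW hdW))
      (z k' : Π v : S, UnitaryGroup.localPi L (IsCMField.complexConj L) (n + n) (hermD L e dV hdV dW hdW) v.1), (∀ v, k' v ∈ K' v) → fS (a, z * k') = fS (a, z) := by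
    intro a z k' hk'
    rw [hfS_def]
    exact congrArg (fun c : ℂ => φi a * c) (Finset.prod_congr rfl fun v _ => hφv_inv v (z v) (k' v) (hk' v))
  /- §E. THE WITNESSES: `K'`, `φ♭ := fS ⊗ ⊗'_{v∉S} Λ_{s₀,v}` (★ (c1)), `g := (g_∞ ∘ Φ_∞) ⊗ ⊗_{v∈S} (g_v ∘ κ_v)`. -/
  refine ⟨K', fun h => fS (UnitaryGroup.archPart (Fp L) L (IsCMField.complexConj L) (n + n) (hermD L e dV hdV dW hdW) h, fun v : S => UnitaryGroup.evalPlace (Fp L) L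
      (IsCMField.complexConj L) (n + n) (hermD L e dV hdV dW hdW) v.1 (UnitaryGroup.finPart (Fp L) L (IsCMField.complexConj L) (n + n) (hermD L e dV hdV dW hdW) h)) *
      ∏ᶠ v : {v : HeightOneSpectrum (𝓞 (Fp L)) // v ∉ S}, LambdaLoc L e dV hdV dW hdW v.1 χ s₀ (UnitaryGroup.evalPlace (Fp L) L (IsCMField.complexConj L) (n + n)
        (hermD L e dV hdV dW hdW) v.1 (UnitaryGroup.finPart (Fp L) L (IsCMField.complexConj L) (n + n) (hermD L e dV hdV dW hdW) h)),
    fun x => gi (Φi x.1) * ∏ v : S, gv v (κ v (x.2 v)), hK'o,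
    isSiegelDeltaSection_restrictedProduct L e dV hdV dW hdW S χ s₀ _hχ (siegelDeltaCharacter_trivial_on_KS L e dV hdV _hdV0 dW hdW _hdW0 S χ s₀ _hχ) fS hfS,
    continuous_restrictedProduct L e dV hdV dW hdW S χ s₀ _hχ fS hfSc,
    fun h k hk1 hk2 hk3 => restrictedProduct_mul_of_mem_KS_prod L e dV hdV dW hdW S χ s₀ _hχ K' fS hfSK h k hk1 hk2 hk3, ?_, ?_, ?_, ?_⟩
  /- §G. THE READ-BACK along `ι ∘ ιA ∘ placesEmbed` (§3) and the packages' read-backs. -/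
  · rintro ⟨a, y⟩
    rw [restrictedProduct_iotaLeft_iotaA_placesEmbed L e dV hdV dW hdW H g ιA _hιA S χ s₀ _hχ fS Φi hΦi (fun v => κ v) hκ a y, hfS_def]
    simp only [hφi_read, hφv_read, Complex.ofReal_mul, Complex.ofReal_prod]
  /- §H. `0 ≤ g`. -/
  · exact fun x => mul_nonneg (hgi_nn _) (Finset.prod_nonneg fun v _ => hgv_nn v _)
  /- §I. `supp g ⊆ U_∞ × ∏ U_v ⊆ U`. -/
  · intro x hx
    rw [Function.mem_support] at hx
    have hx1 : x.1 ∈ Ui := by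
      have h := hgi_supp (Function.mem_support.2 (left_ne_zero_of_mul hx))
      rwa [Set.mem_preimage, ContinuousMulEquiv.symm_apply_apply] at h
    have hx2 : x.2 ∈ W := hUvW (Set.mem_univ_pi.2 fun v => by
      have h := hgv_supp v (Function.mem_support.2 ((Finset.prod_ne_zero_iff.1 (right_ne_zero_of_mul hx)) v (Finset.mem_univ v)))
      rwa [Set.mem_preimage, ContinuousMulEquiv.symm_apply_apply] at h)
    exact hUW ⟨hx1, hx2⟩
  /- §J. `∫ g > 0` (§4), the bumps transported along the homeomorphisms `Φ_∞`, `κ_v`. -/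
  · refine integral_tensor_bump_pos L H S νinf νS (fun a => gi (Φi a)) (hgi_cont.comp Φi.continuous)
      (HasCompactSupport.of_support_subset_isCompact (hgi_cs.isCompact.image Φi.symm.continuous) fun a ha =>
        ⟨Φi a, subset_tsupport _ ha, Φi.symm_apply_apply a⟩)
      (fun a => hgi_nn _) (by rw [map_one]; exact hgi_one) (fun v x => gv v (κ v x)) (fun v => (hgv_cont v).comp (κ v).continuous)
      (fun v => HasCompactSupport.of_support_subset_isCompact ((hgv_cs v).isCompact.image (κ v).symm.continuous) fun x hx =>
        ⟨κ v x, subset_tsupport _ hx, (κ v).symm_apply_apply x⟩)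
      (fun v x => hgv_nn v _) fun v => by rw [map_one]; exact hgv_one v

end Summit.HodgeConjecture.HodgeConjecture.Cruxes.HLiu418.K2LiuSiegelBigCellSectionOfLocal

end
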